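import Mathlib
import HarnessLib

/-!
# Crux `FrobeniusLadder.FRationalResolution` (stmt-ResolutionOfSingularities-15317), line `redirect`,
# stub `stub_diagonalizableQuotientResolution` — THE RESIDUE SLOT `hres` OF A CHARTED MODEL: `κ`-rationality of `T_𝔳` for a
# model presented as a quotient of a polynomial ring (or any `κ`-algebra generated by elements of `𝔳`)

The charted-model consumers (`…FixedPointTwoStepModel(Isolated)`, `…LocalToricModelBlowup(AtPrime)`,
`…TwoStepChartFactsInterface`) ask for `hres : ∀ z : T_𝔳, ∃ c : κ, z - c ∈ 𝔪_{T_𝔳}`. For the sub-algebra presentation of a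
monomial algebra this is `…MonomialAlgebraVertex.exists_sub_algebraMap_mem_maximalIdeal`; here is the generic form and its
discharge for QUOTIENT presentations `T = κ[X₁,…,X_N]/I`, `𝔳 ⊇ (x̄₁,…,x̄_N)` — the frame in which per-class chart computations
are meant to be done.

* ★ `exists_sub_algebraMap_mem_maximalIdeal_of_forall` — if every `t ∈ T` is a scalar modulo `𝔳` then every element of `T_𝔳` is a
  scalar modulo `𝔪_{T_𝔳}`;
* `mvPolynomial_sub_C_mem_span_X` — `p - C (p 0) ∈ (X_i : i)`;
* ★ `exists_sub_algebraMap_mem_of_surjective` — for a surjective `κ`-algebra map `f : κ[X_i : i ∈ σ] → T` with every `f X_i ∈ 𝔳`,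
  every `t ∈ T` is a scalar modulo `𝔳`;
* ★★ `exists_sub_algebraMap_mem_maximalIdeal_of_surjective` — hence `hres` for such `(T, 𝔳)`.

Honest label: elementary plumbing toward ONE leaf stub (no stub, crux or summit closed). No definitions, no named facts, no sorry.
[folklore; cite: Matsumura1987, §1 (residue fields of localizations)]
-/

noncomputable section

-- single-problem summit: the doubled namespace component is forced
set_option linter.dupNamespace false

open IsLocalRing

namespace Summit.ResolutionOfSingularities.ResolutionOfSingularities.Theorems.FRationalResolution.QuotientModelResidue

/-- ★ **Residue surjectivity passes to the localization.** `T` a `κ`-algebra (`κ` a field), `𝔳` maximal with every `t ∈ T` a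
scalar modulo `𝔳`; then every element of `T_𝔳` is a scalar modulo `𝔪_{T_𝔳}` (`t/s ≡ c/c'`). [folklore] -/
theorem exists_sub_algebraMap_mem_maximalIdeal_of_forall (κ : Type) [Field κ] {T : Type} [CommRing T] [Algebra κ T]
    (𝔳 : Ideal T) [h𝔳 : 𝔳.IsMaximal] (hT : ∀ t : T, ∃ c : κ, t - algebraMap κ T c ∈ 𝔳)
    (x : Localization.AtPrime 𝔳) :
    ∃ c : κ, x - algebraMap κ (Localization.AtPrime 𝔳) c ∈ maximalIdeal (Localization.AtPrime 𝔳) := by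
  obtain ⟨⟨t, s⟩, rfl⟩ := IsLocalization.mk'_surjective 𝔳.primeCompl x
  dsimp only
  obtain ⟨c, hc⟩ := hT t
  obtain ⟨c', hc'⟩ := hT (s : T)
  have hc'0 : c' ≠ 0 := by
    rintro rfl
    rw [map_zero, sub_zero] at hc'
    exact s.2 hc'
  refine ⟨c / c', ?_⟩
  have key : t - algebraMap κ T (c / c') * (s : T) ∈ 𝔳 := by
    have h : algebraMap κ T (c / c') * algebraMap κ T c' = algebraMap κ T c := by
      rw [← map_mul, div_mul_cancel₀ c hc'0]
    have : t - algebraMap κ T (c / c') * (s : T) =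
        (t - algebraMap κ T c) - algebraMap κ T (c / c') * ((s : T) - algebraMap κ T c') := by
      linear_combination -h
    rw [this]
    exact Ideal.sub_mem _ hc (Ideal.mul_mem_left _ _ hc')
  have hu : IsUnit (algebraMap T (Localization.AtPrime 𝔳) (s : T)) :=
    IsLocalization.map_units (Localization.AtPrime 𝔳) s
  rw [← Ideal.mul_unit_mem_iff_mem _ hu]
  have e1 : (IsLocalization.mk' (Localization.AtPrime 𝔳) t s - algebraMap κ (Localization.AtPrime 𝔳) (c / c')) *
      algebraMap T (Localization.AtPrime 𝔳) (s : T) =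
      algebraMap T (Localization.AtPrime 𝔳) (t - algebraMap κ T (c / c') * (s : T)) := by
    have h1 : IsLocalization.mk' (Localization.AtPrime 𝔳) t s * algebraMap T (Localization.AtPrime 𝔳) (s : T) =
        algebraMap T (Localization.AtPrime 𝔳) t := IsLocalization.mk'_spec _ t s
    have h2 : algebraMap κ (Localization.AtPrime 𝔳) (c / c') =
        algebraMap T (Localization.AtPrime 𝔳) (algebraMap κ T (c / c')) :=
      IsScalarTower.algebraMap_apply κ T (Localization.AtPrime 𝔳) _
    rw [map_sub, map_mul, ← h1, h2]
    ring
  rw [e1, ← Localization.AtPrime.map_eq_maximalIdeal]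
  exact Ideal.mem_map_of_mem _ key

/-- `p - C (coeff 0 p) ∈ (X_i : i)` for every polynomial. [folklore] -/
theorem mvPolynomial_sub_C_mem_span_X {σ : Type*} (κ : Type) [Field κ] (p : MvPolynomial σ κ) :
    p - MvPolynomial.C (MvPolynomial.coeff 0 p) ∈ Ideal.span (Set.range (MvPolynomial.X : σ → MvPolynomial σ κ)) := by
  classical
  rw [← Set.image_univ, MvPolynomial.mem_ideal_span_X_image]
  intro m hm
  by_contra h
  push Not at h
  have hm0 : m = 0 := by
    ext i
    simpa using h i (Set.mem_univ i)
  subst hm0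
  rw [MvPolynomial.mem_support_iff, MvPolynomial.coeff_sub, MvPolynomial.coeff_zero_C, sub_self] at hm
  exact hm rfl

/-- ★ **Every element of a `κ`-algebra generated by elements of `𝔳` is a scalar modulo `𝔳`**: `f : κ[X_i : i ∈ σ] → T` a
surjective `κ`-algebra map with `f X_i ∈ 𝔳` for all `i`. [folklore] -/
theorem exists_sub_algebraMap_mem_of_surjective (κ : Type) [Field κ] {T : Type} [CommRing T] [Algebra κ T] {σ : Type*}
    (f : MvPolynomial σ κ →ₐ[κ] T) (hf : Function.Surjective f) (𝔳 : Ideal T) (hX : ∀ i, f (MvPolynomial.X i) ∈ 𝔳)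
    (t : T) : ∃ c : κ, t - algebraMap κ T c ∈ 𝔳 := by
  obtain ⟨p, rfl⟩ := hf t
  refine ⟨MvPolynomial.coeff 0 p, ?_⟩
  have h1 : f p - algebraMap κ T (MvPolynomial.coeff 0 p) = f (p - MvPolynomial.C (MvPolynomial.coeff 0 p)) := by
    rw [map_sub, ← MvPolynomial.algebraMap_eq, AlgHom.commutes]
  rw [h1]
  have h2 : (Ideal.span (Set.range (MvPolynomial.X : σ → MvPolynomial σ κ))).map f ≤ 𝔳 := by
    rw [Ideal.map_span, Ideal.span_le]
    rintro _ ⟨_, ⟨i, rfl⟩, rfl⟩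
    exact hX i
  exact h2 (Ideal.mem_map_of_mem _ (mvPolynomial_sub_C_mem_span_X κ p))

/-- ★★ **`hres` FOR A QUOTIENT-PRESENTED MODEL.** `f : κ[X_i : i ∈ σ] → T` a surjective `κ`-algebra map, `𝔳` a maximal ideal
containing every `f X_i`: every element of `T_𝔳` is a scalar modulo `𝔪_{T_𝔳}` — the hypothesis `hres` of the charted-model
consumers. [folklore] -/
theorem exists_sub_algebraMap_mem_maximalIdeal_of_surjective (κ : Type) [Field κ] {T : Type} [CommRing T] [Algebra κ T]
    {σ : Type*} (f : MvPolynomial σ κ →ₐ[κ] T) (hf : Function.Surjective f) (𝔳 : Ideal T) [h𝔳 : 𝔳.IsMaximal]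
    (hX : ∀ i, f (MvPolynomial.X i) ∈ 𝔳) (x : Localization.AtPrime 𝔳) :
    ∃ c : κ, x - algebraMap κ (Localization.AtPrime 𝔳) c ∈ maximalIdeal (Localization.AtPrime 𝔳) :=
  exists_sub_algebraMap_mem_maximalIdeal_of_forall κ 𝔳 (exists_sub_algebraMap_mem_of_surjective κ f hf 𝔳 hX) x

end Summit.ResolutionOfSingularities.ResolutionOfSingularities.Theorems.FRationalResolution.QuotientModelResidue

end
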